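import Literature.NumberTheory.Sieve.SmoothTwistedSaddleRange
import Literature.NumberTheory.Sieve.SmoothSaddleKernelWindow
import HarnessLib

/-!
# The twisted saddle point at the scales `x/e` with a parametric window

Topic `Literature/NumberTheory/Sieve`; a PROVED file generalising `SmoothTwistedSaddle`
([HildebrandTenenbaum1986, §4 (Lemmas 10–11)], [Harper2016, §5]). With `W_λ(v) = v²(1−v)²e(λv)`,
`α = α(x,y)`, `φ = φ₂(α,y)`, `𝓜 = x^α ζ(α,y)/√(2πφ)` and the scaled kernel
`A_{λ,e}(t) = e^{−(α+it)} Ŵ_λ(α+it)` of `SmoothTwistedSaddle` (`B₀ = 2e^{−α}/(1+|λ|)`,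
`B₁ = (2 + 2 log e)e^{−α}/(1+|λ|)`, `B_a = e^{−α}`, `B₃ = e^{−α} C_λ`), the kernel theorem
`SaddleKernel.norm_kernelIntegral_sub_main_le_window` (window `τ = W/√φ`, `W > 0` a PARAMETER) gives

`norm_scaledSum_sub_main_le_window`: `‖S_w(λ; x/e) − e^{−α} 𝓜 Ŵ_λ(α)‖ ≤ (x^αζ(α,y)/(2π)) e^{−α} · E_W`,

where `E_W` is the error bracket of `TwistedWeight.norm_scaledSum_sub_main_le_param` with its two FIXED
floors `e^{−2500}`, `e^{−72}` replaced by `e^{−W²/4}`, `e^{−W²/140}`. The proof is that of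
`norm_scaledSum_sub_main_le_param` verbatim. The rest of the file is the `W`- and kernel-independent
bookkeeping of the three decay terms and of the window term of `E_W` in the range
`(log x)^4 ≤ y ≤ exp((log x)^{1/5})` (`err_window_le`, `err_midrange_le`, `err_farrange_le`,
`err_decay_le`: each is `≤ (5/8)δ` past an explicit threshold in `log x`), extracted from the proof of
`TwistedWeight.scaledSum_main_term` so that the range theorem with the window chosen in terms of `ε`
(`SmoothTwistedSaddleWindowRange`) stays short.

## References

* A. J. Harper, Compositio Math. 152 (2016), §5 [Harper2016].
* A. Hildebrand, G. Tenenbaum, Trans. AMS 296 (1986), §4 (Lemmas 10–11) [HildebrandTenenbaum1986].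
-/

noncomputable section

open Real Complex MeasureTheory Set Filter
open scoped FourierTransform Topology

namespace Literature.NumberTheory.Sieve

namespace TwistedWeight

/-! ### The scaled twisted sum with a parametric window -/

set_option maxHeartbeats 1000000 in
/-- **The twisted saddle point at the scale `x/e`, parametric window.** With `𝓜 = x^α ζ(α,y)/√(2πφ)`,
`α = α(x,y)`, `φ = φ₂(α,y)`, `W > 0`, under the range hypotheses (window `τ = W/√φ ≤ π/log y ≤ 1`,
`13τ³ log y φ ≤ 1`) and the decay of `ζ(α+it,y)/ζ(α,y)` (`≤ ε₁` on `π/log y ≤ |t| ≤ 3`, `≤ ε₂` on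
`3 ≤ |t| ≤ T`): `‖S_w(λ; x/e) − e^{−α} 𝓜 Ŵ_λ(α)‖ ≤ (x^α ζ(α,y)/(2π)) e^{−α} · E_W`, where `E_W` collects
the window, Gaussian-completion (`e^{−W²/4}`) and tail (`e^{−W²/140}`, `ε₁`, `ε₂`, `C_λ/T²`) errors of
`SaddleKernel.norm_kernelIntegral_sub_main_le_window` (`W = 100`: `norm_scaledSum_sub_main_le_param`).
[cite: HildebrandTenenbaum1986, §4 (Lemmas 10–11)] [cite: Harper2016, §5] -/
theorem norm_scaledSum_sub_main_le_window {x T ε₁ ε₂ W : ℝ} {y : ℕ} (hx : 1 < x) (hy : 2 ≤ y)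
    (hα : 3 / 5 ≤ saddlePoint x y) (hα1 : saddlePoint x y ≤ 1) (hφ0 : 0 < saddlePhi₂ (saddlePoint x y) y)
    (hW : 0 < W) (hτ : W / Real.sqrt (saddlePhi₂ (saddlePoint x y) y) ≤ Real.pi / Real.log y)
    (hy1 : Real.pi / Real.log y ≤ 1)
    (hη : 13 * (W / Real.sqrt (saddlePhi₂ (saddlePoint x y) y)) ^ 3 * Real.log y *
      saddlePhi₂ (saddlePoint x y) y ≤ 1)
    (hT : 3 ≤ T) (hε₁ : 0 ≤ ε₁) (hε₂ : 0 ≤ ε₂)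
    (hdec1 : ∀ t : ℝ, Real.pi / Real.log y ≤ |t| → |t| ≤ 3 →
      ‖smoothZetaC ((saddlePoint x y : ℂ) + t * I) y‖ / smoothZeta (saddlePoint x y) y ≤ ε₁)
    (hdec2 : ∀ t : ℝ, 3 ≤ |t| → |t| ≤ T →
      ‖smoothZetaC ((saddlePoint x y : ℂ) + t * I) y‖ / smoothZeta (saddlePoint x y) y ≤ ε₂)
    {e : ℕ} (he : 1 ≤ e) (lam : ℝ) :
    ‖(∑ n ∈ Nat.smoothNumbersUpTo ⌊x / e⌋₊ (y + 1), twistWeight lam (n / (x / e))) -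
        ((((e : ℝ) ^ (-saddlePoint x y) * (x ^ saddlePoint x y * smoothZeta (saddlePoint x y) y /
            Real.sqrt (2 * Real.pi * saddlePhi₂ (saddlePoint x y) y)) : ℝ)) : ℂ) * twistMellin lam (saddlePoint x y)‖ ≤
      (x ^ saddlePoint x y * smoothZeta (saddlePoint x y) y / (2 * Real.pi)) * (e : ℝ) ^ (-saddlePoint x y) *
        ((2950 * Real.log y + 8 + 8 * Real.log e) / (saddlePhi₂ (saddlePoint x y) y * (1 + |lam|)) +
          2 / (1 + |lam|) * (Real.exp (-(W ^ 2 / 4)) * Real.sqrt (4 * Real.pi / saddlePhi₂ (saddlePoint x y) y)) +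
          ((2 / (1 + |lam|)) * Real.exp (-(W ^ 2 / 140)) * Real.sqrt (125 * Real.pi ^ 3 / saddlePhi₂ (saddlePoint x y) y) +
            20 * Real.pi * ε₁ / (saddlePoint x y * (1 + |lam|)) + 2 * Real.pi * ε₂ * T +
            2 * Real.pi * (2 + 6 * (2 * π * |lam|) + 6 * (2 * π * |lam|) ^ 2 + (2 * π * |lam|) ^ 3) / T ^ 2)) := by
  set α : ℝ := saddlePoint x y with hαdef
  have hα0 : 0 < α := by linarith
  set φ : ℝ := saddlePhi₂ α y with hφ
  have hx0 : 0 < x := by linarith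
  have he0 : 0 < e := he
  have he0' : (0 : ℝ) < e := by exact_mod_cast he0
  have hloge : 0 ≤ Real.log e := Real.log_nonneg (by exact_mod_cast he)
  set c : ℝ := x ^ α * smoothZeta α y / (2 * Real.pi) with hc
  have hc0 : 0 < c := by have := smoothZeta_pos (y := y) hα0; have := Real.pi_pos; positivity
  set ρ : ℝ := (e : ℝ) ^ (-α) with hρ
  have hρ0 : 0 < ρ := Real.rpow_pos_of_pos he0' _
  -- the kernel constants
  set b₀ : ℝ := 2 * ρ / (1 + |lam|) with hb₀
  have hb₀0 : 0 ≤ b₀ := by positivity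
  set b₁ : ℝ := (2 + 2 * Real.log e) * ρ / (1 + |lam|) with hb₁
  have hb₁0 : 0 ≤ b₁ := by positivity
  set Cl : ℝ := 2 + 6 * (2 * π * |lam|) + 6 * (2 * π * |lam|) ^ 2 + (2 * π * |lam|) ^ 3 with hCl
  have hCl0 : 0 ≤ Cl := by have := Real.pi_pos; positivity
  have hB0 : ∀ t : ℝ, |t| ≤ 3 → ‖scaledKernel α e lam t‖ ≤ b₀ := by
    intro t ht
    rw [norm_scaledKernel he0, hb₀, ← hρ]
    calc ρ * ‖twistMellin lam (α + t * I)‖ ≤ ρ * (2 / (1 + |lam|)) :=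
          mul_le_mul_of_nonneg_left (norm_twistMellin_le_two_div hα0 hα1 ht lam) hρ0.le
      _ = 2 * ρ / (1 + |lam|) := by ring
  have hB1 : ∀ t : ℝ, |t| ≤ 1 → ‖scaledKernel α e lam t - scaledKernel α e lam 0‖ ≤ b₁ * |t| := by
    intro t ht
    have hW3 : ‖twistMellin lam (α + t * I)‖ ≤ 2 / (1 + |lam|) :=
      norm_twistMellin_le_two_div hα0 hα1 (ht.trans (by norm_num)) lam
    have hvar := norm_twistMellin_sub_le (σ := α) (by linarith) t lam
    have hph := norm_natCast_cpow_neg_mul_I_sub_one_le he t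
    -- `A(t) − A(0) = e^{-α}[(e^{-it} − 1) Ŵ(α+it) + (Ŵ(α+it) − Ŵ(α))]`
    have he0c : (e : ℂ) ≠ 0 := by exact_mod_cast he0.ne'
    have hsplit : (e : ℂ) ^ (-((α : ℂ) + t * I)) = (e : ℂ) ^ (-(α : ℂ)) * (e : ℂ) ^ (-((t : ℂ) * I)) := by
      rw [neg_add, Complex.cpow_add _ _ he0c]
    have hdec : scaledKernel α e lam t - scaledKernel α e lam 0 =
        (e : ℂ) ^ (-(α : ℂ)) * (((e : ℂ) ^ (-((t : ℂ) * I)) - 1) * twistMellin lam (α + t * I) +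
          (twistMellin lam (α + t * I) - twistMellin lam α)) := by
      simp only [scaledKernel]
      rw [hsplit]
      push_cast
      rw [zero_mul, add_zero]
      ring
    have hρC : ‖(e : ℂ) ^ (-(α : ℂ))‖ = ρ := by
      rw [hρ, Complex.norm_natCast_cpow_of_pos he0]; simp
    rw [hdec, norm_mul, hρC, hb₁]
    calc ρ * ‖((e : ℂ) ^ (-((t : ℂ) * I)) - 1) * twistMellin lam (α + t * I) +
          (twistMellin lam (α + t * I) - twistMellin lam α)‖
        ≤ ρ * (‖(e : ℂ) ^ (-((t : ℂ) * I)) - 1‖ * ‖twistMellin lam (α + t * I)‖ +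
            ‖twistMellin lam (α + t * I) - twistMellin lam α‖) := by
          apply mul_le_mul_of_nonneg_left _ hρ0.le
          rw [← norm_mul]; exact norm_add_le _ _
      _ ≤ ρ * ((|t| * Real.log e) * (2 / (1 + |lam|)) + 2 * |t| / (1 + |lam|)) := by
          apply mul_le_mul_of_nonneg_left _ hρ0.le
          exact add_le_add (mul_le_mul hph hW3 (norm_nonneg _) (by positivity)) hvar
      _ = (2 + 2 * Real.log e) * ρ / (1 + |lam|) * |t| := by ring
  have hBall : ∀ t : ℝ, ‖scaledKernel α e lam t‖ ≤ ρ := by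
    intro t
    rw [norm_scaledKernel he0, ← hρ]
    calc ρ * ‖twistMellin lam (α + t * I)‖ ≤ ρ * 1 :=
          mul_le_mul_of_nonneg_left (norm_twistMellin_le_one (by simp; exact hα0.le) lam) hρ0.le
      _ = ρ := mul_one _
  have hB3 : ∀ t : ℝ, T < |t| → ‖scaledKernel α e lam t‖ ≤ ρ * Cl / |t| ^ 3 := by
    intro t ht
    have hs : 0 < ((α : ℂ) + t * I).re := by simp; exact hα0
    have hWd := norm_twistMellin_le_decay hs lam
    rw [← hCl] at hWd
    have hge : ∀ k : ℝ, |t| ≤ ‖(α : ℂ) + t * I + k‖ := by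
      intro k
      have : |((α : ℂ) + t * I + k).im| ≤ ‖(α : ℂ) + t * I + k‖ := Complex.abs_im_le_norm _
      simpa using this
    have hprod : |t| ^ 3 ≤ ‖(α : ℂ) + t * I + 2‖ * ‖(α : ℂ) + t * I + 3‖ * ‖(α : ℂ) + t * I + 4‖ := by
      have h2 := hge 2; have h3 := hge 3; have h4 := hge 4
      push_cast at h2 h3 h4
      calc |t| ^ 3 = |t| * |t| * |t| := by ring
        _ ≤ _ := by
          apply mul_le_mul (mul_le_mul h2 h3 (abs_nonneg _) (norm_nonneg _)) h4 (abs_nonneg _) (by positivity)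
    have habs0 : 0 < |t| := lt_of_le_of_lt (by linarith) ht
    rw [norm_scaledKernel he0, ← hρ, mul_div_assoc]
    exact mul_le_mul_of_nonneg_left (hWd.trans (div_le_div_of_nonneg_left hCl0 (by positivity) hprod)) hρ0.le
  have hK := SaddleKernel.norm_kernelIntegral_sub_main_le_window hx hy hα hα1 hφ0 hW hτ hy1 hη hT hε₁ hε₂ hdec1
    hdec2 (continuous_scaledKernel hα0 he0 lam) (integrable_scaledKernel hα0 he0 lam) hb₀0 hb₁0 hρ0.le
    (by positivity) hB0 hB1 hBall hB3
  rw [← hαdef, ← hφ] at hK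
  -- `S_w(λ; x/e) = c ∫ f`, `𝓜 = c √(2π/φ)`, `A 0 = e^{-α} Ŵ_λ(α)`
  have hS := scaledSum_eq_integral hx0 hα0 y he0 lam
  have hA0 : scaledKernel α e lam 0 = (ρ : ℂ) * twistMellin lam α := by
    simp only [scaledKernel]
    push_cast
    rw [zero_mul, add_zero, hρ, Complex.ofReal_cpow he0'.le]
    push_cast
    rfl
  rw [hA0] at hK
  have hmain : x ^ α * smoothZeta α y / Real.sqrt (2 * Real.pi * φ) = c * Real.sqrt (2 * Real.pi / φ) := by
    rw [hc, SaddleKernel.main_const_identity hφ0]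
  rw [hmain, hS]
  have halg : (c : ℂ) * (∫ t, scaledIntegrand x α y e lam t) -
      (((ρ * (c * Real.sqrt (2 * Real.pi / φ)) : ℝ)) : ℂ) * twistMellin lam α =
      (c : ℂ) * ((∫ t, SaddleKernel.kernelIntegrand x α y (scaledKernel α e lam) t) -
        (ρ : ℂ) * twistMellin lam α * (Real.sqrt (2 * Real.pi / φ) : ℂ)) := by
    simp only [scaledIntegrand]
    push_cast; ring
  rw [halg, norm_mul, Complex.norm_real, Real.norm_eq_abs, abs_of_pos hc0]
  rw [show ∀ B : ℝ, c * ρ * B = c * (ρ * B) from fun B => mul_assoc _ _ _]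
  apply mul_le_mul_of_nonneg_left (hK.trans _) hc0.le
  -- compare the two error expressions
  have hw0n : ‖(ρ : ℂ) * twistMellin lam α‖ ≤ b₀ := by
    have := hB0 0 (by norm_num); rwa [hA0] at this
  have hgpos : 0 ≤ Real.exp (-(W ^ 2 / 4)) * Real.sqrt (4 * Real.pi / φ) := by positivity
  have hl : 0 < 1 + |lam| := by positivity
  have h1 : (1475 * b₀ * Real.log y + 4 * b₁) / φ = ρ * ((2950 * Real.log y + 8 + 8 * Real.log e) / (φ * (1 + |lam|))) := by
    rw [hb₀, hb₁]; field_simp; ring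
  have h2 : ‖(ρ : ℂ) * twistMellin lam α‖ * (Real.exp (-(W ^ 2 / 4)) * Real.sqrt (4 * Real.pi / φ)) ≤
      ρ * (2 / (1 + |lam|) * (Real.exp (-(W ^ 2 / 4)) * Real.sqrt (4 * Real.pi / φ))) := by
    calc _ ≤ b₀ * (Real.exp (-(W ^ 2 / 4)) * Real.sqrt (4 * Real.pi / φ)) :=
          mul_le_mul_of_nonneg_right hw0n hgpos
      _ = _ := by rw [hb₀]; ring
  have h3 : b₀ * Real.exp (-(W ^ 2 / 140)) * Real.sqrt (125 * Real.pi ^ 3 / φ) + 10 * Real.pi * ε₁ * b₀ / α +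
      2 * Real.pi * ε₂ * ρ * T + 2 * Real.pi * (ρ * Cl) / T ^ 2 =
      ρ * (2 / (1 + |lam|) * Real.exp (-(W ^ 2 / 140)) * Real.sqrt (125 * Real.pi ^ 3 / φ) +
        20 * Real.pi * ε₁ / (α * (1 + |lam|)) + 2 * Real.pi * ε₂ * T + 2 * Real.pi * Cl / T ^ 2) := by
    rw [hb₀]; field_simp; ring
  rw [h1, h3]
  nlinarith [h2, hρ0]

/-! ### Bookkeeping of the error bracket in the range `(log x)^4 ≤ y ≤ exp((log x)^{1/5})`

In the four lemmas `r = (log x)^{1/5}` (`r⁵ = L = log x`), `ℓ = log y ≤ r`, `Φ = √φ₂ ≤ 2L`, `δ > 0` is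
the target precision, and the thresholds are those of the proof of `scaledSum_main_term`. -/

/-- **The window term**: `(2950 ℓ + 8 + 8 log e)/√φ ≤ (5/8)δ` when `log e ≤ 5Br`, `φ ≥ c L ℓ` (`L = r⁵`,
`11 ≤ ℓ ≤ r`), `r⁴ ≥ 93·10⁶/(cδ²)` and `r³ ≥ 16400 B²/(cδ²)` (then `3000 ℓ ≤ (5δ/16)√φ` and
`40 B r ≤ (5δ/16)√φ`). [folklore] -/
theorem err_window_le {c δ B ℓ r L φ lge : ℝ} (hc : 0 < c) (hδ : 0 < δ) (hℓ11 : 11 ≤ ℓ)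
    (hr1 : 1 ≤ r) (hr5 : r ^ 5 = L) (hℓr : ℓ ≤ r) (hφlo : c * (L * ℓ) ≤ φ) (hφ0 : 0 < φ)
    (hlge : lge ≤ 5 * B * r)
    (hr4Q : 93 * 10 ^ 6 / (c * δ ^ 2) ≤ r ^ 4) (hr3Q : 16400 * B ^ 2 / (c * δ ^ 2) ≤ r ^ 3) :
    (2950 * ℓ + 8 + 8 * lge) / Real.sqrt φ ≤ 5 / 8 * δ := by
  set Φ := Real.sqrt φ with hΦ
  have hΦ0 : 0 < Φ := Real.sqrt_pos.2 hφ0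
  have hΦsq : Φ ^ 2 = φ := Real.sq_sqrt hφ0.le
  have hr0 : 0 < r := by linarith only [hr1]
  have hℓ0 : 0 < ℓ := by linarith only [hℓ11]
  have hL0 : 0 < L := by rw [← hr5]; positivity
  have h1 : c * r ^ 4 * ℓ ^ 2 ≤ φ := by
    have h2 : r ^ 4 * ℓ ≤ L := by
      calc r ^ 4 * ℓ ≤ r ^ 4 * r := mul_le_mul_of_nonneg_left hℓr (by positivity)
        _ = L := by rw [← hr5]; ring
    calc c * r ^ 4 * ℓ ^ 2 = c * ((r ^ 4 * ℓ) * ℓ) := by ring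
      _ ≤ c * (L * ℓ) := by gcongr
      _ ≤ φ := hφlo
  have h1' : c * r ^ 5 ≤ φ := by
    calc c * r ^ 5 = c * (L * 1) := by rw [hr5]; ring
      _ ≤ c * (L * ℓ) := by gcongr; linarith only [hℓ11]
      _ ≤ φ := hφlo
  -- `3000 ℓ ≤ (5δ/16) Φ`
  have h3 : 93 * 10 ^ 6 ≤ c * δ ^ 2 * r ^ 4 := by
    have := hr4Q; rw [div_le_iff₀ (by positivity)] at this; linarith only [this]
  have h4 : (3000 * ℓ) ^ 2 ≤ (5 / 16 * δ * Φ) ^ 2 := by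
    rw [mul_pow (5 / 16 * δ), hΦsq]
    have h5 := mul_le_mul_of_nonneg_right h3 (by positivity : 0 ≤ ℓ ^ 2)
    nlinarith only [h1, h5, hδ, hc]
  have h6 : 3000 * ℓ ≤ 5 / 16 * δ * Φ := le_of_pow_le_pow_left₀ two_ne_zero (by positivity) h4
  -- `40 B r ≤ (5δ/16) Φ`
  have h7 : 16400 * B ^ 2 ≤ c * δ ^ 2 * r ^ 3 := by
    have := hr3Q; rw [div_le_iff₀ (by positivity)] at this; linarith only [this]
  have h8 : (40 * B * r) ^ 2 ≤ (5 / 16 * δ * Φ) ^ 2 := by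
    rw [mul_pow (5 / 16 * δ), hΦsq]
    have h9 := mul_le_mul_of_nonneg_right h7 (by positivity : 0 ≤ r ^ 2)
    nlinarith only [h1', h9, hδ, hc]
  have h10 : 40 * B * r ≤ 5 / 16 * δ * Φ := le_of_pow_le_pow_left₀ two_ne_zero (by positivity) h8
  have h11 : 2950 * ℓ + 8 + 8 * lge ≤ 3000 * ℓ + 40 * B * r := by linarith only [hlge, hℓ11]
  rw [div_le_iff₀ hΦ0]
  linarith only [h6, h10, h11]

/-- **The mid-range decay term**: `20π e^{−A₂ r} Φ/α ≤ (5/8)δ` once `L ≥ 122·10⁷/(A₂¹⁰ δ)`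
(`r⁵ = L`, `Φ ≤ 2L`, `α ≥ 3/5`; via `e^{−z} ≤ 10!/z¹⁰`). [folklore] -/
theorem err_midrange_le {A₂ δ r L Φ α : ℝ} (hA₂ : 0 < A₂) (hδ : 0 < δ) (hr0 : 0 < r) (hr5 : r ^ 5 = L)
    (hΦ0 : 0 ≤ Φ) (hΦle : Φ ≤ 2 * L) (hα35 : 3 / 5 ≤ α) (hLA₂ : 122 * 10 ^ 7 / (A₂ ^ 10 * δ) ≤ L) :
    20 * Real.pi * Real.exp (-(A₂ * r)) * Φ / α ≤ 5 / 8 * δ := by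
  have hπ4 := Real.pi_lt_d4
  have hL0 : 0 < L := by rw [← hr5]; positivity
  have hα0 : 0 < α := by linarith only [hα35]
  have hz : 0 < A₂ * r := by positivity
  have h1 := exp_neg_le_factorial_div_pow hz
  have h2 : (A₂ * r) ^ 10 = A₂ ^ 10 * L ^ 2 := by rw [mul_pow, show r ^ 10 = (r ^ 5) ^ 2 by ring, hr5]
  rw [h2] at h1
  have h3 : 122 * 10 ^ 7 ≤ A₂ ^ 10 * δ * L := by
    have := hLA₂; rw [div_le_iff₀ (by positivity)] at this; linarith only [this]
  rw [div_le_iff₀ hα0]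
  calc 20 * Real.pi * Real.exp (-(A₂ * r)) * Φ ≤ 20 * 3.1416 * (3628800 / (A₂ ^ 10 * L ^ 2)) * (2 * L) := by
        apply mul_le_mul (mul_le_mul (by nlinarith only [hπ4]) h1 (Real.exp_pos _).le (by positivity)) hΦle hΦ0
          (by positivity)
    _ = (20 * 3.1416 * 3628800 * 2) / (A₂ ^ 10 * L) := by field_simp
    _ ≤ 5 / 8 * δ * (3 / 5) := by
        rw [div_le_iff₀ (by positivity)]; nlinarith only [h3, hδ]
    _ ≤ 5 / 8 * δ * α := by nlinarith only [hα35, hδ]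

/-- **The far-range decay term**: `2π e^{−A₃ r³} (κ √y) Φ (1+|λ|) ≤ (5/8)δ` once `r ≥ 2/A₃` and
`L ≥ 147·10⁶ κ/δ` (`r⁵ = L`, `Φ ≤ 2L`, `log y ≤ r`, `Λ⁸ ≤ y`, `|λ| ≤ Λ`: `√y (1+|λ|) ≤ 2e^{5r/8}` while
`A₃ r³ ≥ r + 5r/8`). [folklore] -/
theorem err_farrange_le {A₃ κ δ r L Φ Λ lam : ℝ} {y : ℕ} (hA₃ : 0 < A₃) (hκ : 0 < κ) (hδ : 0 < δ)
    (hr1 : 1 ≤ r) (hr5 : r ^ 5 = L) (hrA : 2 / A₃ ≤ r) (hΦ0 : 0 ≤ Φ) (hΦle : Φ ≤ 2 * L)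
    (hy0 : 0 < (y : ℝ)) (hℓr : Real.log y ≤ r) (hΛy : Λ ^ 8 ≤ y) (hΛ1 : 1 ≤ Λ) (hlam : |lam| ≤ Λ)
    (hLκ : 147 * 10 ^ 6 * κ / δ ≤ L) :
    2 * Real.pi * Real.exp (-(A₃ * r ^ 3)) * (κ * (y : ℝ) ^ (1 / 2 : ℝ)) * Φ * (1 + |lam|) ≤ 5 / 8 * δ := by
  have hπ4 := Real.pi_lt_d4
  have hr0 : 0 < r := by linarith only [hr1]
  have hL0 : 0 < L := by rw [← hr5]; positivity
  have hlam0 : 0 < 1 + |lam| := by positivity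
  have hlam1 : 1 + |lam| ≤ 2 * Λ := by linarith only [hlam, hΛ1]
  have hsqy_exp : (y : ℝ) ^ (1 / 2 : ℝ) ≤ Real.exp (r / 2) := by
    rw [Real.rpow_def_of_pos hy0]
    exact Real.exp_le_exp.2 (by linarith only [hℓr])
  have hΛexp : Λ ≤ Real.exp (r / 8) := by
    have h1 : Λ ^ 8 ≤ Real.exp (r / 8) ^ 8 := by
      rw [← Real.exp_nat_mul]
      calc Λ ^ 8 ≤ y := hΛy
        _ = Real.exp (Real.log y) := by rw [Real.exp_log hy0]
        _ ≤ Real.exp ((8 : ℕ) * (r / 8)) := Real.exp_le_exp.2 (by push_cast; linarith only [hℓr])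
    exact le_of_pow_le_pow_left₀ (by norm_num) (Real.exp_pos _).le h1
  -- `A₃ r³ ≥ r + 5r/8` since `A₃ r ≥ 2`
  have hA3r : r + (r / 2 + r / 8) ≤ A₃ * r ^ 3 := by
    have h2 : 2 ≤ A₃ * r := by rw [div_le_iff₀ hA₃] at hrA; linarith only [hrA]
    have h3 : 2 * r ≤ A₃ * r ^ 2 := by nlinarith only [h2, hr0]
    have h4 : A₃ * r ^ 2 ≤ A₃ * r ^ 3 := by
      apply mul_le_mul_of_nonneg_left _ hA₃.le; nlinarith only [hr1, hr0]
    linarith only [h3, h4, hr0]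
  have hexp : Real.exp (-(A₃ * r ^ 3)) * ((y : ℝ) ^ (1 / 2 : ℝ) * (1 + |lam|)) ≤ 2 * Real.exp (-r) := by
    calc Real.exp (-(A₃ * r ^ 3)) * ((y : ℝ) ^ (1 / 2 : ℝ) * (1 + |lam|))
        ≤ Real.exp (-(A₃ * r ^ 3)) * (Real.exp (r / 2) * (2 * Real.exp (r / 8))) := by
          apply mul_le_mul_of_nonneg_left _ (Real.exp_pos _).le
          exact mul_le_mul hsqy_exp (hlam1.trans (by linarith only [hΛexp])) hlam0.le (Real.exp_pos _).le
      _ = 2 * Real.exp (-(A₃ * r ^ 3) + r / 2 + r / 8) := by rw [Real.exp_add, Real.exp_add]; ring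
      _ ≤ 2 * Real.exp (-r) := by
          apply mul_le_mul_of_nonneg_left (Real.exp_le_exp.2 _) (by norm_num); linarith only [hA3r]
  have h1 := exp_neg_le_factorial_div_pow hr0
  rw [show r ^ 10 = L ^ 2 by rw [show r ^ 10 = (r ^ 5) ^ 2 by ring, hr5]] at h1
  have h3 : 147 * 10 ^ 6 * κ ≤ δ * L := by
    have := hLκ; rw [div_le_iff₀ hδ] at this; linarith only [this]
  calc 2 * Real.pi * Real.exp (-(A₃ * r ^ 3)) * (κ * (y : ℝ) ^ (1 / 2 : ℝ)) * Φ * (1 + |lam|)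
      = 2 * Real.pi * κ * Φ * (Real.exp (-(A₃ * r ^ 3)) * ((y : ℝ) ^ (1 / 2 : ℝ) * (1 + |lam|))) := by ring
    _ ≤ 2 * 3.1416 * κ * (2 * L) * (2 * Real.exp (-r)) := by
        apply mul_le_mul _ hexp (by positivity) (by positivity)
        exact mul_le_mul (by nlinarith only [hπ4, hκ]) hΦle hΦ0 (by positivity)
    _ ≤ 2 * 3.1416 * κ * (2 * L) * (2 * (3628800 / L ^ 2)) := by
        apply mul_le_mul_of_nonneg_left (mul_le_mul_of_nonneg_left h1 (by norm_num)) (by positivity)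
    _ = (2 * 3.1416 * 2 * 2 * 3628800) * κ / L := by field_simp
    _ ≤ 5 / 8 * δ := by rw [div_le_iff₀ hL0]; nlinarith only [h3, hκ]

/-- **The kernel-decay term**: `2π C_λ Φ (1+|λ|)/(κ² y) ≤ (5/8)δ` once `L ≥ 31000/(κ²δ)`
(`C_λ (1+|λ|) ≤ 1500 Λ⁴ ≤ 1500 √y` by `decayConst_le`, `Φ ≤ 2L`, `L² ≤ √y`). [folklore] -/
theorem err_decay_le {κ δ L Φ Λ lam : ℝ} {y : ℕ} (hκ : 0 < κ) (hδ : 0 < δ) (hL0 : 0 < L)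
    (hΦ0 : 0 ≤ Φ) (hΦle : Φ ≤ 2 * L) (hy0 : 0 < (y : ℝ)) (hy4 : L ^ 4 ≤ y) (hΛy : Λ ^ 8 ≤ y)
    (hΛ1 : 1 ≤ Λ) (hlam : |lam| ≤ Λ) (hLκ2 : 31000 / (κ ^ 2 * δ) ≤ L) :
    2 * Real.pi * (2 + 6 * (2 * π * |lam|) + 6 * (2 * π * |lam|) ^ 2 + (2 * π * |lam|) ^ 3) /
      (κ * (y : ℝ) ^ (1 / 2 : ℝ)) ^ 2 * Φ * (1 + |lam|) ≤ 5 / 8 * δ := by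
  have hπ4 := Real.pi_lt_d4
  have hlam0 : 0 < 1 + |lam| := by positivity
  have hlam1 : 1 + |lam| ≤ 2 * Λ := by linarith only [hlam, hΛ1]
  have hsqy : ((y : ℝ) ^ (1 / 2 : ℝ)) ^ 2 = y := by
    rw [← Real.rpow_natCast, ← Real.rpow_mul hy0.le]; norm_num
  have hsqy0 : 0 < (y : ℝ) ^ (1 / 2 : ℝ) := Real.rpow_pos_of_pos hy0 _
  have hΛ4 : Λ ^ 4 ≤ (y : ℝ) ^ (1 / 2 : ℝ) := by
    have h1 : (Λ ^ 4) ^ 2 ≤ ((y : ℝ) ^ (1 / 2 : ℝ)) ^ 2 := by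
      rw [hsqy]
      calc (Λ ^ 4) ^ 2 = Λ ^ 8 := by ring
        _ ≤ (y : ℝ) := hΛy
    exact le_of_pow_le_pow_left₀ two_ne_zero hsqy0.le h1
  have hL2sq : L ^ 2 ≤ (y : ℝ) ^ (1 / 2 : ℝ) := by
    have h1 : (L ^ 2) ^ 2 ≤ ((y : ℝ) ^ (1 / 2 : ℝ)) ^ 2 := by
      rw [hsqy]
      calc (L ^ 2) ^ 2 = L ^ 4 := by ring
        _ ≤ (y : ℝ) := hy4
    exact le_of_pow_le_pow_left₀ two_ne_zero hsqy0.le h1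
  have hC := decayConst_le hΛ1 hlam
  have hden : (κ * (y : ℝ) ^ (1 / 2 : ℝ)) ^ 2 = κ ^ 2 * y := by rw [mul_pow, hsqy]
  rw [hden]
  have h1 : (2 + 6 * (2 * π * |lam|) + 6 * (2 * π * |lam|) ^ 2 + (2 * π * |lam|) ^ 3) * (1 + |lam|) ≤
      1500 * (y : ℝ) ^ (1 / 2 : ℝ) := by
    calc _ ≤ 750 * Λ ^ 3 * (2 * Λ) := mul_le_mul hC hlam1 hlam0.le (by positivity)
      _ = 1500 * Λ ^ 4 := by ring
      _ ≤ 1500 * (y : ℝ) ^ (1 / 2 : ℝ) := by linarith only [hΛ4]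
  have h2 : (y : ℝ) ^ (1 / 2 : ℝ) * (L * L) ≤ (y : ℝ) := by
    calc (y : ℝ) ^ (1 / 2 : ℝ) * (L * L) = (y : ℝ) ^ (1 / 2 : ℝ) * L ^ 2 := by ring
      _ ≤ (y : ℝ) ^ (1 / 2 : ℝ) * (y : ℝ) ^ (1 / 2 : ℝ) := mul_le_mul_of_nonneg_left hL2sq hsqy0.le
      _ = y := by rw [← sq, hsqy]
  have h3 : 31000 ≤ κ ^ 2 * δ * L := by
    have := hLκ2; rw [div_le_iff₀ (by positivity)] at this; linarith only [this]
  rw [show 2 * Real.pi * (2 + 6 * (2 * π * |lam|) + 6 * (2 * π * |lam|) ^ 2 + (2 * π * |lam|) ^ 3) / (κ ^ 2 * ↑y) * Φ *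
      (1 + |lam|) = 2 * Real.pi * Φ * ((2 + 6 * (2 * π * |lam|) + 6 * (2 * π * |lam|) ^ 2 + (2 * π * |lam|) ^ 3) *
      (1 + |lam|)) / (κ ^ 2 * y) by ring]
  rw [div_le_iff₀ (by positivity)]
  calc 2 * Real.pi * Φ * ((2 + 6 * (2 * π * |lam|) + 6 * (2 * π * |lam|) ^ 2 + (2 * π * |lam|) ^ 3) * (1 + |lam|))
      ≤ 2 * 3.1416 * (2 * L) * (1500 * (y : ℝ) ^ (1 / 2 : ℝ)) := by
        apply mul_le_mul (mul_le_mul (by nlinarith only [hπ4]) hΦle hΦ0 (by positivity)) h1 (by positivity)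
          (by positivity)
    _ = (2 * 3.1416 * 2 * 1500) * ((y : ℝ) ^ (1 / 2 : ℝ) * L) := by ring
    _ ≤ 5 / 8 * δ * (κ ^ 2 * y) := by
        have h4 : (2 * 3.1416 * 2 * 1500) * ((y : ℝ) ^ (1 / 2 : ℝ) * L) * L ≤ 5 / 8 * δ * (κ ^ 2 * y) * L := by
          calc (2 * 3.1416 * 2 * 1500) * ((y : ℝ) ^ (1 / 2 : ℝ) * L) * L
              = (2 * 3.1416 * 2 * 1500) * ((y : ℝ) ^ (1 / 2 : ℝ) * (L * L)) := by ring
            _ ≤ (2 * 3.1416 * 2 * 1500) * y := by nlinarith only [h2]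
            _ ≤ 5 / 8 * δ * (κ ^ 2 * y) * L := by nlinarith only [h3, hy0]
        exact le_of_mul_le_mul_right h4 hL0

end TwistedWeight

end Literature.NumberTheory.Sieve

end
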